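import Summits.ResolutionOfSingularities.ResolutionOfSingularities.Theorems.HilbertSamuelEliminationSigmaMaxModificationsCorridor3WLadderStrataDepth
import Summits.ResolutionOfSingularities.ResolutionOfSingularities.Theorems.HilbertSamuelEliminationSigmaMaxModificationsCorridor3RegularCentresPermissible
import Literature.AlgebraicGeometry.Resolution.PermissibleBlowupFibreDimension
import Literature.AlgebraicGeometry.Resolution.FibreCoheightInequality
import HarnessLib

/-!
# [OURS · L1 W4.2] `Corridor3WLadderStrataDepthMoving` — «MOVING BIRTHS ARE CURVES»: conjunct (a) of res-type-040's
# binder `StrataDepthDiscipline` PROVED at level `N = 3`, and **`StrataDepthDiscipline p 3 (QNe Q) G` DISCHARGED** for every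
# `p` (all characteristics, `p = 2` included), every origin predicate `Q`, every grade `G`

Crux chain w42 (`SigmaMaxModifications`, stmt-ResolutionOfSingularities-18506; conjunct `SigmaMaxModificationsCorridor3`,
stmt-ResolutionOfSingularities-19249), object D13-DD «DEPTH DISCIPLINE» (res-L1-w42-plan-1 RULINGS v3.13-3 (AM)). Seat res-type-053
(gen 10). OURS (cell res-hironaka, slot W4.2); NOT statements of H. Hironaka's manuscript [Hironaka2017] nor of
[CossartJannsenSaito2020]; AI-proved, weaker than expert review. Sorry-free PROOF file (no definition, no named fact, no binder; no
`CharHypothesis`, no Thm. 3.14). `--supports stmt-ResolutionOfSingularities-19249 --as helper`.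

THE ARGUMENT (040's docstring of `StrataDepthDiscipline` (a), made char-free). At a cycle-end step `X_n ← X_{n+1}` of a chain under
the cycle invariant, a MOVING birth `Z' ∋ x_{n+1}` has its image closure `B` strictly inside its HOST `S ∋ x_n`, a component of
`X_n(ν)` inside the canonical centre `C` with a sandwich at `x_n` (040's `IsMovingBirthAt.exists_host`). Hence
`dim 𝒪_{V(C),x_n} ≥ codim_S(x_n) ≥ 2`, while `dim 𝒪_{X_n,x_n} ≤ 3`; `C` is permissible at `x_n` (`CycleInv.centre`), so by the
FIBRE DIMENSION of a permissible blow-up (LIB `IsBlowup.ringKrullDim_stalk_quotient_map_maximalIdeal_add_le`, CJS p. 46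
`F = Proj(A)`) the fibre local ring `𝒪_{X_{n+1},x_{n+1}}/𝔪_{x_n}` has dimension `0`; by Matsumura 15.1 in codimension form (LIB
`coheight_le_coheight_closure_image_add_ringKrullDim_fibre`) `codim_{Z'}(x_{n+1}) ≤ codim_B(x_n)`; and `codim_B(x_n) ≤ 1` because
`B ⊊ S`, and the generic point of `S` is not a maximal point of `X_n` (`H(η_S) = ν ≠ Φ^{(3)}`, reduced stage), inside
`codim_{X_n}(x_n) ≤ 3`. So `Z'` has no sandwich at the closed point `x_{n+1}`.

* `coheight_le_ringKrullDim_quotient_stalkIdeal` — `codim_{V(I)}(x) ≤ dim 𝒪_{X,x}/I_x` (generisations of `x` inside `Supp I`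
  give primes above `I_x`; general lemma);
* `shallowMovingBirths_three` — conjunct (a) at `N = 3`, at EVERY cycle-end step of every chain from a maximal origin with
  `ν ≠ Φ^{(3)}` (admissible functional oracle);
* `strataDepthDiscipline_three` — **`StrataDepthDiscipline p 3 (QNe Q) G`**, by `strataDepthDiscipline_of_shallowMovingBirths`.

So D13's structural binder is no longer a hypothesis at level 3: `strataCycleEndNoMovingBirths_of_centreIO … (hD := strataDepthDiscipline_three)`.
-/

noncomputable section

set_option linter.dupNamespace false

open CategoryTheory AlgebraicGeometry TopologicalSpace Topology Order IsLocalRing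
open Summit.ResolutionOfSingularities.ResolutionOfSingularities.Theorems.CampaignW42
open Literature.AlgebraicGeometry.Resolution Literature.RingTheory.HilbertSamuel
open Summit.ResolutionOfSingularities.ResolutionOfSingularities.Theorems.SigmaMaxModificationsCorridor3
open Scheme.IdealSheafData

namespace Summit.ResolutionOfSingularities.ResolutionOfSingularities.Theorems.SigmaMaxModificationsCorridor3.Moving

universe u

variable {R : ∀ S : Scheme.{u}, CentreSeq S → Prop} {ν : ℕ → ℕ}

/-! ## §1 Codimension inside a closed subscheme's support vs. the dimension of `𝒪_{X,x}/I_x` -/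

/-- **`codim_Z(x) ≤ dim 𝒪_{X,x}/𝓘(Z)_x`** for a closed subset `Z ∋ x` and its vanishing ideal sheaf: the generisations of `x`
inside `Z`, with specialisation reversed, map strictly monotonically to the primes of `𝒪_{X,x}` above `𝓘(Z)_x`
(`fromSpecStalk_mem_iff_stalkIdeal_le`). [cite: StacksProject, Tag 01J7] -/
theorem coheight_le_ringKrullDim_quotient_stalkIdeal_vanishingIdeal {X : Scheme.{u}} (Z : Closeds X) {x : X}
    (hx : x ∈ (Z : Set X)) :
    ((coheight (⟨x, hx⟩ : ↥(Z : Set X)) : ℕ∞) : WithBot ℕ∞) ≤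
      ringKrullDim (X.presheaf.stalk x ⧸ stalkIdeal (vanishingIdeal Z) x) := by
  set x₀ : ↥(Z : Set X) := ⟨x, hx⟩ with hx₀
  rw [coheight_eq_krullDim_Ici, ringKrullDim_quotient, ← krullDim_orderDual (α := ↥(Set.Ici x₀))]
  set pt : PrimeSpectrum (X.presheaf.stalk x) → X := fun q => (X.fromSpecStalk x).base q with hpt
  have hpt_iff : ∀ q q' : PrimeSpectrum (X.presheaf.stalk x), pt q ⤳ pt q' ↔ q.asIdeal ≤ q'.asIdeal :=
    fun q q' => fromSpecStalk_specializes_iff_le q q'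
  let G : (↥(Set.Ici x₀))ᵒᵈ →
      PrimeSpectrum.zeroLocus (R := X.presheaf.stalk x) (stalkIdeal (vanishingIdeal Z) x : Set (X.presheaf.stalk x)) :=
    fun y => ⟨⟨primeOfSpecializes (Scheme.le_iff_specializes.mp (OrderDual.ofDual y).2), inferInstance⟩, by
      have hmem : pt ⟨primeOfSpecializes (Scheme.le_iff_specializes.mp (OrderDual.ofDual y).2), inferInstance⟩ ∈ Z := by
        rw [show pt ⟨primeOfSpecializes (Scheme.le_iff_specializes.mp (OrderDual.ofDual y).2), inferInstance⟩ =
          ((OrderDual.ofDual y).1 : X) from Literature.AlgebraicGeometry.Motives.fromSpecStalk_comap_maximalIdeal _]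
        exact (OrderDual.ofDual y).1.2
      exact (fromSpecStalk_mem_iff_stalkIdeal_le Z _).mp hmem⟩
  have hGpt : ∀ y, pt (G y).1 = ((OrderDual.ofDual y).1 : X) := fun y =>
    Literature.AlgebraicGeometry.Motives.fromSpecStalk_comap_maximalIdeal _
  have hG : StrictMono G := by
    intro y y' hyy'
    have hlt : OrderDual.ofDual y' < OrderDual.ofDual y := hyy'
    have hle : ((OrderDual.ofDual y).1 : X) ⤳ ((OrderDual.ofDual y').1 : X) :=
      Scheme.le_iff_specializes.mp (le_of_lt hlt)
    have hnle : ¬ ((OrderDual.ofDual y').1 : X) ⤳ ((OrderDual.ofDual y).1 : X) := fun e =>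
      (lt_iff_le_not_ge.mp hlt).2 (Scheme.le_iff_specializes.mpr e)
    change (G y).1 < (G y').1
    refine lt_iff_le_not_ge.mpr ⟨?_, ?_⟩
    · rw [← PrimeSpectrum.asIdeal_le_asIdeal, ← hpt_iff, hGpt, hGpt]
      exact hle
    · intro e
      apply hnle
      rw [← hGpt y, ← hGpt y']
      exact (hpt_iff _ _).mpr ((PrimeSpectrum.asIdeal_le_asIdeal _ _).mpr e)
  exact krullDim_le_of_strictMono G hG

/-- **`codim_{Supp I}(x) ≤ dim 𝒪_{X,x}/I_x`** for an ideal sheaf `I` and `x ∈ Supp I` (`I ⊆ 𝓘(Supp I)`, so `𝒪_x/I_x ↠ 𝒪_x/𝓘_x`).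
[cite: StacksProject, Tag 01J7] -/
theorem coheight_le_ringKrullDim_quotient_stalkIdeal {X : Scheme.{u}} (I : X.IdealSheafData) {x : X}
    (hx : x ∈ (I.support : Set X)) :
    ((coheight (⟨x, hx⟩ : ↥(I.support : Set X)) : ℕ∞) : WithBot ℕ∞) ≤
      ringKrullDim (X.presheaf.stalk x ⧸ stalkIdeal I x) := by
  have hle : stalkIdeal I x ≤ stalkIdeal (vanishingIdeal I.support) x :=
    stalkIdeal_mono (le_support_iff_le_vanishingIdeal.mp le_rfl) x
  refine (coheight_le_ringKrullDim_quotient_stalkIdeal_vanishingIdeal I.support hx).trans ?_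
  exact ringKrullDim_le_of_surjective (Ideal.Quotient.factor hle) (Ideal.Quotient.factor_surjective hle)

/-! ## §2 Conjunct (a): a moving birth through the chain point is a curve there -/

/-- **MOVING BIRTHS ARE CURVES (conjunct (a) of `StrataDepthDiscipline` at `N = 3`).** Along a chain of canonical near steps
(admissible functional oracle) from a maximal origin with `ν ≠ Φ^{(3)}`, at a CYCLE-END step (`(c (n+1)).P = none`) read through
its step projection `f`, a moving-birth newborn component `Z' ∋ x_{n+1}` of `X_{n+1}(ν)` has NO sandwich at `x_{n+1}`
(`codim_{Z'}(x_{n+1}) ≤ 1`): the fibre of the blow-up over `x_n` is finite (the host `S ⊆ V(C)` of the birth is a surface germ at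
`x_n` — `dim 𝒪_{V(C),x_n} ≥ 2` — in `dim 𝒪_{X_n,x_n} ≤ 3`, LIB `PermissibleBlowupFibreDimension`), so `codim_{Z'}(x_{n+1}) ≤ codim_B(x_n)`
(LIB `FibreCoheightInequality`) for `B = cl f(Z') ⊊ S`, and `codim_B(x_n) ≤ 1`. Every characteristic.
[cite: CossartJannsenSaito2020, Thm. 3.10 (proof, p. 46)] [cite: Matsumura1987, Thm. 15.1] -/
theorem shallowMovingBirths_three {p : ℕ} (hRf : OracleFunctional R) (hRa : OracleAdmissible R) (hν : ν ≠ iterPSum 3 Phi)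
    {X : Scheme.{u}} [IsLocallyNoetherian X] {x : X} (hX : IsMaximalOrigin p 3 ν X x) {c : ℕ → MarkedStage.{u}}
    (h0 : Reaches R 3 ν (MarkedStage.init X x) (c 0)) (hstep : ∀ n, CanonicalNearStep R 3 ν (c n) (c (n + 1))) (n : ℕ)
    {f : (c (n + 1)).W ⟶ (c n).W} (hf : StepProjection R 3 ν (c n) (c (n + 1)) f) (hnone : (c (n + 1)).P = none)
    {Z' : Set (c (n + 1)).W} (hZ' : IsMovingBirthAt 3 ν (c n) (c (n + 1)) f Z') : ¬ HasSandwichAt (c (n + 1)) Z' := by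
  intro hsand
  obtain ⟨k, _, hinv⟩ := exists_cycleInv_chain hRa hν hX h0 hstep
  haveI := (c n).ln
  haveI := (c (n + 1)).ln
  haveI : IsReduced (c n).W := (hinv n).isReduced
  -- the host of the birth
  obtain ⟨S, hS, -, hSC, hBS, hBneS, hsandS⟩ := hZ'.exists_host hRf hRa hν (hinv n) (hstep n) hnone hf
  obtain ⟨C, P', hcs, hbl⟩ := hf.exists_isCanonicalStep_and_isBlowup
  have hSsub : S ⊆ (C.support : Set (c n).W) := hSC C P' hcs
  obtain ⟨-, -, hpermC, -⟩ := (hinv n).centre hRa hν hcs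
  -- the points and the sets
  set x' : (c (n + 1)).W := (c (n + 1)).pt with hx'def
  have hZ'c : Z' ∈ componentsThrough 3 ν (c (n + 1)) := hZ'.1.1
  have hirrZ' : IsIrreducible Z' := componentsIn.isIrreducible hZ'c.1
  have hclZ' : IsClosed Z' := componentsIn.isClosed (hinv (n + 1)).isClosed_hsStratum hZ'c.1
  have hx'Z' : x' ∈ Z' := hZ'c.2
  have hfx : f.base x' = (c n).pt := hf.base_pt
  -- `y = f x' = x_n`, `B = cl f(Z')`
  have hirrB : IsIrreducible (closure (f.base '' Z')) := (hirrZ'.image f.base f.continuous.continuousOn).closure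
  have hyB : f.base x' ∈ closure (f.base '' Z') := subset_closure ⟨x', hx'Z', rfl⟩
  have hirrS : IsIrreducible S := componentsIn.isIrreducible hS.1
  have hclS : IsClosed S := componentsIn.isClosed (hinv n).isClosed_hsStratum hS.1
  have hyS : f.base x' ∈ S := by rw [hfx]; exact hS.2
  have hyC : f.base x' ∈ (C.support : Set (c n).W) := hSsub hyS
  -- `2 ≤ codim_{Z'}(x')` (the sandwich) and `2 ≤ codim_S(y)` (the host's sandwich)
  have h2Z' : 2 ≤ coheight (⟨x', hx'Z'⟩ : ↥Z') :=
    (two_le_coheight_iff_exists_sandwich hirrZ' hclZ' hx'Z' hf.isClosed_pt).mpr hsand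
  have h2S : 2 ≤ coheight (⟨f.base x', hyS⟩ : ↥S) := by
    have h := (two_le_coheight_iff_exists_sandwich hirrS hclS hS.2
      (Reaches.isClosed_pt hX.isClosed (reaches_chain h0 hstep n))).mpr hsandS
    have e : (⟨(c n).pt, hS.2⟩ : ↥S) = ⟨f.base x', hyS⟩ := Subtype.ext hfx.symm
    rwa [e] at h
  -- `dim 𝒪_{X_n,y} ≤ 3`
  have hyX : coheight (f.base x') ≤ (3 : ℕ) :=
    (topologicalKrullDim_le_iff_forall_coheight_le (c n).W 3).mp (hinv n).dim_le (f.base x')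
  have hdimX : ringKrullDim ((c n).W.presheaf.stalk (f.base x')) ≤ ((3 : ℕ) : WithBot ℕ∞) := by
    rw [AlgebraicGeometry.ringKrullDim_stalk_eq_coheight]
    have h' : ((coheight (f.base x') : ℕ∞) : WithBot ℕ∞) ≤ (((3 : ℕ) : ℕ∞) : WithBot ℕ∞) := WithBot.coe_le_coe.mpr hyX
    rwa [WithBot.coe_natCast] at h'
  -- `dim 𝒪_{V(C),y} = s ≥ 2`
  have hperm : IdealSheafData.IsPermissibleAt C (f.base x') := hpermC (f.base x') hyC
  haveI hregC : IsRegularLocalRing ((c n).W.presheaf.stalk (f.base x') ⧸ stalkIdeal C (f.base x')) := hperm.1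
  obtain ⟨s, hs⟩ : ∃ s : ℕ, ringKrullDim ((c n).W.presheaf.stalk (f.base x') ⧸ stalkIdeal C (f.base x')) = s :=
    exists_nat_eq_of_ne_bot_of_ne_top ringKrullDim_ne_bot ringKrullDim_ne_top
  have h2s : 2 ≤ s := by
    have h1 : ((coheight (⟨f.base x', hyC⟩ : ↥(C.support : Set (c n).W)) : ℕ∞) : WithBot ℕ∞) ≤
        (((s : ℕ) : ℕ∞) : WithBot ℕ∞) := by
      have h := coheight_le_ringKrullDim_quotient_stalkIdeal C hyC
      rw [hs] at h
      rwa [← WithBot.coe_natCast] at h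
    have h1' : (coheight (⟨f.base x', hyC⟩ : ↥(C.support : Set (c n).W)) : ℕ∞) ≤ (s : ℕ∞) :=
      WithBot.coe_le_coe.mp h1
    have h2 : coheight (⟨f.base x', hyS⟩ : ↥S) ≤ coheight (⟨f.base x', hyC⟩ : ↥(C.support : Set (c n).W)) :=
      coheight_le_coheight_apply_of_strictMono (fun z : ↥S => (⟨z.1, hSsub z.2⟩ : ↥(C.support : Set (c n).W)))
        (fun _ _ h => h) ⟨f.base x', hyS⟩
    have h3 : ((2 : ℕ) : ℕ∞) ≤ (s : ℕ∞) := by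
      have h4 : (2 : ℕ∞) ≤ (s : ℕ∞) := h2S.trans (h2.trans h1')
      exact_mod_cast h4
    exact_mod_cast h3
  -- the fibre of the blow-up over `y` is zero-dimensional at `x'`
  have hfib : ringKrullDim ((c (n + 1)).W.presheaf.stalk x' ⧸
      (maximalIdeal ((c n).W.presheaf.stalk (f.base x'))).map (f.stalkMap x').hom) ≤ 0 := by
    have key := hbl.ringKrullDim_stalk_quotient_map_maximalIdeal_add_le x' hperm hs
    set F := ringKrullDim ((c (n + 1)).W.presheaf.stalk x' ⧸
      (maximalIdeal ((c n).W.presheaf.stalk (f.base x'))).map (f.stalkMap x').hom) with hF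
    -- `F + (s + 1) ≤ 3 ≤ 0 + (s + 1)`
    have h1 : F + ((s + 1 : ℕ) : WithBot ℕ∞) ≤ 0 + ((s + 1 : ℕ) : WithBot ℕ∞) := by
      refine (key.trans hdimX).trans ?_
      rw [zero_add]; exact_mod_cast (by omega : 3 ≤ s + 1)
    -- cancel
    haveI : Nontrivial ((c (n + 1)).W.presheaf.stalk x' ⧸
        (maximalIdeal ((c n).W.presheaf.stalk (f.base x'))).map (f.stalkMap x').hom) := by
      refine Ideal.Quotient.nontrivial_iff.mpr (ne_top_of_le_ne_top (Ideal.IsPrime.ne_top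
        (inferInstance : (maximalIdeal ((c (n + 1)).W.presheaf.stalk x')).IsPrime)) ?_)
      rw [Ideal.map_le_iff_le_comap]
      exact fun r hr => map_nonunit (f.stalkMap x').hom r hr
    obtain ⟨e, he⟩ : ∃ e : ℕ∞, F = e := by
      obtain ⟨e, he⟩ := WithBot.ne_bot_iff_exists.mp
        (ne_bot_of_le_ne_bot WithBot.coe_ne_bot (ringKrullDim_nonneg_of_nontrivial (R := (c (n + 1)).W.presheaf.stalk x' ⧸
          (maximalIdeal ((c n).W.presheaf.stalk (f.base x'))).map (f.stalkMap x').hom)))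
      exact ⟨e, he.symm⟩
    rw [he] at h1 ⊢
    have h2 : e + ((s + 1 : ℕ) : ℕ∞) ≤ 0 + ((s + 1 : ℕ) : ℕ∞) := by exact_mod_cast h1
    exact_mod_cast (ENat.add_le_add_iff_right (ENat.coe_ne_top _)).mp h2
  -- Matsumura 15.1: `codim_{Z'}(x') ≤ codim_B(y) + 0`
  have hM := coheight_le_coheight_closure_image_add_ringKrullDim_fibre f hirrZ' hclZ' hx'Z'
  have hZ'B : coheight (⟨x', hx'Z'⟩ : ↥Z') ≤ coheight (⟨f.base x', hyB⟩ : ↥(closure (f.base '' Z'))) := by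
    have h1 : ((coheight (⟨x', hx'Z'⟩ : ↥Z') : ℕ∞) : WithBot ℕ∞) ≤
        ((coheight (⟨f.base x', hyB⟩ : ↥(closure (f.base '' Z'))) : ℕ∞) : WithBot ℕ∞) + 0 :=
      hM.trans (add_le_add le_rfl hfib)
    rw [add_zero] at h1
    exact_mod_cast h1
  -- `codim_B(y) ≤ 1`: `B ⊊ S`, `η_S` is not a maximal point of `X_n`, `codim_{X_n}(y) ≤ 3`
  have hgenS : IsGenericPoint hirrS.genericPoint S := hirrS.isGenericPoint_genericPoint hclS
  set ηS := hirrS.genericPoint with hηS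
  have hηSν : Scheme.hsFun (c n).W 3 ηS = ν := Scheme.mem_hsStratum_iff.mp (componentsIn.subset hS.1 hgenS.mem)
  have hηS_notmax : ¬ IsMax ηS := by
    intro hmax
    have hco : coheight ηS = 0 := coheight_eq_zero.mpr hmax
    have hdim0 : ringKrullDim ((c n).W.presheaf.stalk ηS) = 0 := by
      rw [AlgebraicGeometry.ringKrullDim_stalk_eq_coheight, hco]; rfl
    have hmin : maximalIdeal ((c n).W.presheaf.stalk ηS) ∈ minimalPrimes ((c n).W.presheaf.stalk ηS) := by
      rw [← Ideal.height_eq_zero_iff]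
      have h := IsLocalRing.maximalIdeal_height_eq_ringKrullDim (R := (c n).W.presheaf.stalk ηS)
      rw [hdim0] at h
      exact_mod_cast h
    have hΦ := Helpers.hsFun_eq_iterPSum_Phi_of_maximalIdeal_mem_minimalPrimes (Y := (c n).W) 3 hmin
    exact hν (hηSν.symm.trans hΦ)
  obtain ⟨ξ, hξ⟩ := not_isMax_iff.mp hηS_notmax
  have hB1 : coheight (⟨f.base x', hyB⟩ : ↥(closure (f.base '' Z'))) ≤ 1 := by
    refine coheight_le_iff'.mpr fun q hq => ?_
    -- `q` in `B` from `y`; its last point is `< η_S < ξ` in `X_n`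
    have hlast : (q.last : (c n).W) < ηS := by
      have hmemS : (q.last : (c n).W) ∈ S := hBS q.last.2
      refine lt_iff_le_not_ge.mpr ⟨Scheme.le_iff_specializes.mpr (hgenS.specializes hmemS), fun hle => hBneS ?_⟩
      -- `η_S ∈ B` would give `S ⊆ B`
      have hηB : ηS ∈ closure (f.base '' Z') := by
        have : ηS ∈ closure ({(q.last : (c n).W)} : Set (c n).W) :=
          specializes_iff_mem_closure.mp (Scheme.le_iff_specializes.mp hle)
        exact closure_minimal (Set.singleton_subset_iff.mpr q.last.2) isClosed_closure this
      refine le_antisymm hBS ?_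
      rw [← hgenS.def]
      exact closure_minimal (Set.singleton_subset_iff.mpr hηB) isClosed_closure
    let r : LTSeries (c n).W := ((q.map Subtype.val fun _ _ h => h).snoc ηS (by
      rw [LTSeries.last_map]; exact hlast)).snoc ξ (by rw [RelSeries.last_snoc]; exact hξ)
    have hrhead : r.head = f.base x' := by
      simp only [r, RelSeries.head_snoc, LTSeries.head_map, hq]
    have hrlen : r.length = q.length + 2 := by
      simp only [r, RelSeries.snoc_length, LTSeries.map_length]
    have h := length_le_coheight_head (p := r)
    rw [hrhead, hrlen] at h
    have h' : ((q.length + 2 : ℕ) : ℕ∞) ≤ 3 := h.trans hyX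
    have h'' : q.length + 2 ≤ 3 := by exact_mod_cast h'
    exact_mod_cast (by omega : q.length ≤ 1)
  -- contradiction
  have : (2 : ℕ∞) ≤ 1 := h2Z'.trans (hZ'B.trans hB1)
  exact absurd this (by decide)

/-! ## §3 The binder discharged at level 3 -/

/-- **`StrataDepthDiscipline p 3 (QNe Q) G` — DISCHARGED** (every `p`, `Q`, `G`): conjunct (a) is `shallowMovingBirths_three`,
conjunct (b) is `exists_centre_of_hasSandwichAt` (file `…StrataDepth`, `strataDepthDiscipline_of_shallowMovingBirths`).
[cite: CossartJannsenSaito2020, Thm. 3.10 (proof, p. 46)] [cite: Matsumura1987, Thm. 15.1, Thm. 15.5] -/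
theorem strataDepthDiscipline_three {p : ℕ} {Q : ℕ → (ℕ → ℕ) → ∀ X : Scheme.{u}, X → Prop} {G : MarkedStage.{u} → Prop} :
    StrataDepthDiscipline p 3 (QNe Q) G :=
  strataDepthDiscipline_of_shallowMovingBirths fun _ hRf hRa _ _ _ _ hX hQ _ h0 hstep _ _ _ n _ hf hnone _ hZ' =>
    shallowMovingBirths_three hRf hRa hQ.2 hX h0 hstep n hf hnone hZ'

end Summit.ResolutionOfSingularities.ResolutionOfSingularities.Theorems.SigmaMaxModificationsCorridor3.Moving

end
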